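import Summits.QuantumFields.YangMills.Theorems.LangevinControlUVOSLegsFromFemtoAndGapStubAssemblyRPLimit
import Summits.QuantumFields.YangMills.Theorems.LangevinControlUVOSLegsFromFemtoAndGapStubAssemblyLowDegree
import Summits.QuantumFields.YangMills.Theorems.LangevinControlUVOSLegsFromFemtoAndGapStubAssemblyInheritance
import Literature.MathematicalPhysics.QuantumLattice.SchwartzTranslationCutoff
import Literature.MathematicalPhysics.QuantumLattice.SchwingerOSPositivity
import HarnessLib

/-!
# Soft OS-assembly toolkit XXI: reflection positivity (E2) of the soft limit

Helper file for stub `stub_assembly6` of crux `OSLegsFromFemtoAndGap` (stmt-QuantumFields-9367, line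
`dlr-collar-transfer`, reshape r2).  Along a scheme `(βₖ, Lₖ, aₖ)` with `aₖ → 0`, `aₖ Lₖ → ∞`, `βₖ ≥ 0`, whose
centred density distributions converge on `⁰𝒮` to a one-field family `S₁` and whose plane strings obey the shift
defect bound (all exported by the joint soft legs, toolkit XV):
* `rp_nonneg_of_compactTime`: for a time-ordered tuple with COMPACT time support the OS form
  `z = Σᵢⱼ S₁(ΘFᵢ* ⊗ Fⱼ)` satisfies `0 ≤ Re z`, `Im z = 0` — `z = lim zₖ` (lattice OS forms, toolkit XX **Z**),
  `pₖ ≥ 0` (the reflection-positivity square, toolkits XVII–XIX, **P**), `|zₖ − pₖ| = O(aₖ)` (toolkit XX);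
* `isReflectionPositive_of_softLimit`: **E2** for `S₁.toLabelled`, by density of compactly supported time-ordered
  tuples (`exists_tsupport_subset_inter_closedBall_tendsto`) and joint continuity of the OS pairing
  (`tendsto_appendTensor`, `continuous_osAdjoint`).
-/

noncomputable section

open scoped SchwartzMap BigOperators ComplexConjugate
open MeasureTheory Filter Topology
open Literature.MathematicalPhysics.QuantumFieldTheory Literature.MathematicalPhysics.QuantumLattice
open Literature.MathematicalPhysics.AQFT
open Literature.Probability.LatticeModels (box Site)
open Summit.QuantumFields.YangMills.Cruxes.OSLegsFromFemtoAndGap.DlrCollarTransfer (plane torusE)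

namespace Summit.QuantumFields.YangMills.Theorems.OSLegsFromFemtoAndGap

local notation "E4" => EuclideanSpace ℝ (Fin 4)

variable {G : Type} [Group G] [TopologicalSpace G] [IsTopologicalGroup G] [CompactSpace G]
  [MeasurableSpace G] [BorelSpace G]

/-! ### Strings of length `≤ 1` have no defect -/

/-- A plane string over an index type with at most one element has vanishing centred weight when it is
non-empty (the centred first moment vanishes). -/
theorem torusMomentStr_plane_eq_zero_of_subsingleton (r : LatticeRep G) (β : ℝ) (L : ℕ) {m : ℕ}
    (hsub : ∀ i j : Fin m, i = j) (i₀ : Fin m) (rr : Fin m → Fin 4 × Fin 4) (z : Fin m → Site 4) :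
    torusMomentStr r.ρ β L (fun i U => plaquetteObs r.ρ 0 (rr i).1 (rr i).2 U)
      (fun i => wilsonTorusMean r.ρ β L (fun U => plaquetteObs r.ρ 0 (rr i).1 (rr i).2 U)) z = 0 := by
  haveI : Subsingleton (Fin m) := ⟨hsub⟩
  haveI := isProbabilityMeasure_wilsonMeasure (d := 4) (L := 2 * L + 1) r.ρ r.continuous β
  unfold torusMomentStr
  simp_rw [Fintype.prod_subsingleton _ i₀]
  have hint : Integrable (fun U : GaugeConfig 4 (2 * L + 1) G =>
      plaquetteObs r.ρ 0 (rr i₀).1 (rr i₀).2 (configShift (-(z i₀)) (torusLift (2 * L + 1) U)))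
      (wilsonMeasure (d := 4) (L := 2 * L + 1) r.ρ β) := integrable_plane_lift r β L (rr i₀) (z i₀)
  have h2 : ∫ U, plaquetteObs r.ρ 0 (rr i₀).1 (rr i₀).2 (configShift (-(z i₀)) (torusLift (2 * L + 1) U))
      ∂(wilsonMeasure (d := 4) (L := 2 * L + 1) r.ρ β) =
      wilsonTorusMean r.ρ β L (fun U => plaquetteObs r.ρ 0 (rr i₀).1 (rr i₀).2 U) :=
    torusE_plane_eq_wilsonTorusMean r β L (rr i₀) (z i₀)
  rw [integral_sub hint (integrable_const _), integral_const, probReal_univ, one_smul, h2, sub_self]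

/-- The shift-defect sum vanishes identically for strings of length `≤ 1`. -/
theorem defectSum_eq_zero_of_le_one (r : LatticeRep G) (β : ℝ) (L : ℕ) (a : ℝ) {m : ℕ} (hm : m ≤ 1)
    (rr : Fin m → Fin 4 × Fin 4) (F : 𝓢((Fin m → E4), ℂ)) (c : Fin m → E4) :
    ∑ z ∈ Fintype.piFinset (fun _ : Fin m => box 4 L),
        ((torusMomentStr r.ρ β L (fun i U => plaquetteObs r.ρ 0 (rr i).1 (rr i).2 U)
          (fun i => wilsonTorusMean r.ρ β L (fun U => plaquetteObs r.ρ 0 (rr i).1 (rr i).2 U)) z : ℝ) : ℂ) *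
        (F ((fun l => a • siteToE (z l)) + c) - F (fun l => a • siteToE (z l))) = 0 := by
  refine Finset.sum_eq_zero fun z _ => ?_
  rcases Nat.lt_or_ge 0 m with h | h
  · rw [torusMomentStr_plane_eq_zero_of_subsingleton r β L (fun i j => Fin.ext (by omega)) ⟨0, h⟩ rr z,
      Complex.ofReal_zero, zero_mul]
  · haveI : IsEmpty (Fin m) := ⟨fun i => absurd i.2 (by omega)⟩
    rw [Subsingleton.elim ((fun l => a • siteToE (z l)) + c) (fun l => a • siteToE (z l)), sub_self, mul_zero]

/-! ### Small limit lemma -/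

/-- If `zₖ → z`, `pₖ` are "non-negative" complex numbers and `‖zₖ − pₖ‖ ≤ εₖ → 0`, then `z` is non-negative. -/
theorem nonneg_of_tendsto_of_near {z : ℂ} {zk pk : ℕ → ℂ} {ε : ℕ → ℝ} (hz : Tendsto zk atTop (𝓝 z))
    (hp : ∀ᶠ k in atTop, 0 ≤ (pk k).re ∧ (pk k).im = 0) (hε : Tendsto ε atTop (𝓝 0))
    (hnear : ∀ᶠ k in atTop, ‖zk k - pk k‖ ≤ ε k) : 0 ≤ z.re ∧ z.im = 0 := by
  have hre : Tendsto (fun k => (zk k).re) atTop (𝓝 z.re) := (Complex.continuous_re.tendsto z).comp hz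
  have him : Tendsto (fun k => (zk k).im) atTop (𝓝 z.im) := (Complex.continuous_im.tendsto z).comp hz
  constructor
  · refine le_of_tendsto_of_tendsto (by simpa using hε.neg) hre ?_
    filter_upwards [hp, hnear] with k hk hn
    have h1 : |(zk k - pk k).re| ≤ ε k := (Complex.abs_re_le_norm _).trans hn
    rw [Complex.sub_re, abs_le] at h1
    linarith [hk.1]
  · have h0 : Tendsto (fun k => (zk k).im) atTop (𝓝 0) := by
      refine squeeze_zero_norm' ?_ hε
      filter_upwards [hp, hnear] with k hk hn
      have h1 : |(zk k - pk k).im| ≤ ε k := (Complex.abs_im_le_norm _).trans hn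
      rwa [Complex.sub_im, hk.2, sub_zero] at h1
    exact tendsto_nhds_unique him h0

/-! ### E2 for compactly supported tuples -/

/-- **Reflection positivity of the soft limit on compactly-time-supported tuples.** -/
theorem rp_nonneg_of_compactTime (r : LatticeRep G) {βk : ℕ → ℝ} {Lk : ℕ → ℕ} {ak : ℕ → ℝ} {K : ℝ} (hK : 0 ≤ K)
    (hβ : ∀ k, 0 ≤ βk k) (hL : ∀ k, 1 ≤ Lk k) (ha : ∀ k, 0 < ak k) (ha0 : Tendsto ak atTop (𝓝 0))
    (haL : Tendsto (fun k => ak k * Lk k) atTop atTop) (S₁ : SchwingerFamily E4)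
    (hlim : ∀ (m : ℕ) (F : 𝓢((Fin m → E4), ℂ)), (2 ≤ m → IsOffDiagonal F) →
      Tendsto (fun k => latticeDist r.ρ (βk k) (Lk k) (ak k) r.curvature.F
        (wilsonTorusMean r.ρ (βk k) (Lk k) r.curvature.F) m F) atTop (𝓝 (S₁ m F)))
    (hdef : ∀ (k m : ℕ), 2 ≤ m → ∀ rr : Fin m → Fin 4 × Fin 4, (∀ i, (rr i).1 < (rr i).2) →
      ∀ F : 𝓢((Fin m → E4), ℂ), IsOffDiagonal F → ∀ c : Fin m → E4, (∀ l, ‖c l‖ ≤ ak k) →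
        ‖∑ z ∈ Fintype.piFinset (fun _ : Fin m => box 4 (Lk k)),
            ((torusMomentStr r.ρ (βk k) (Lk k) (fun i U => plaquetteObs r.ρ 0 (rr i).1 (rr i).2 U)
              (fun i => wilsonTorusMean r.ρ (βk k) (Lk k) (fun U => plaquetteObs r.ρ 0 (rr i).1 (rr i).2 U)) z : ℝ) : ℂ) *
            (F ((fun l => ak k • siteToE (z l)) + c) - F (fun l => ak k • siteToE (z l)))‖ ≤
          2 * ‖c‖ * K ^ m * (SchwartzMap.seminorm ℂ 0 (4 * m + 1) F + SchwartzMap.seminorm ℂ (6 * m) (4 * m + 1) F +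
            SchwartzMap.seminorm ℂ 0 1 F + SchwartzMap.seminorm ℂ (6 * m) 1 F + SchwartzMap.seminorm ℂ (10 * m) 1 F))
    {N : ℕ} {deg : Fin N → ℕ} (F : (j : Fin N) → 𝓢((Fin (deg j) → E4), ℂ)) (hF : ∀ j, IsTimeOrdered (F j))
    {T : ℝ} (hT : ∀ j (u : Fin (deg j) → E4), (∃ l, u l 0 ≤ 0 ∨ T < u l 0) → F j u = 0)
    (H : (i j : Fin N) → 𝓢((Fin (deg i + deg j) → E4), ℂ))
    (hH : ∀ i j, IsAppendTensorOf (H i j) (osAdjoint (F i)) (F j)) :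
    let z := ∑ i, ∑ j, S₁ (deg i + deg j) (H i j)
    0 ≤ z.re ∧ z.im = 0 := by
  classical
  intro z
  -- off-diagonality of the witnesses
  have hHoff : ∀ i j, IsOffDiagonal (H i j) := fun i j => (hH i j).isOffDiagonal_of_isTimeOrdered (hF i) (hF j)
  -- the lattice OS forms and their limit
  set zk : ℕ → ℂ := fun k => ∑ i, ∑ j, latticeDist r.ρ (βk k) (Lk k) (ak k) r.curvature.F
    (wilsonTorusMean r.ρ (βk k) (Lk k) r.curvature.F) (deg i + deg j) (H i j) with hzk
  have hz : Tendsto zk atTop (𝓝 z) :=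
    tendsto_finsetSum _ fun i _ => tendsto_finsetSum _ fun j _ => hlim _ _ fun _ => hHoff i j
  -- the reflection-positivity squares
  set mk : ℕ → Fin 4 × Fin 4 → ℝ := fun k pl =>
    wilsonTorusMean r.ρ (βk k) (Lk k) (fun U => plaquetteObs r.ρ 0 pl.1 pl.2 U) with hmk
  set pk : ℕ → ℂ := fun k => wilsonExpectation (d := 4) (L := 2 * Lk k + 1) r.ρ (βk k) fun U =>
    conj (∑ j, fieldObs r (Lk k) (ak k) (F j) (mk k) U.timeReflect) * ∑ j, fieldObs r (Lk k) (ak k) (F j) (mk k) U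
    with hpk
  have hFvan : ∀ k j (y : Fin (deg j) → Site 4), (∃ l, y l 0 ≤ 0) → F j (fun l => ak k • siteToE (y l)) = 0 :=
    fun k j y ⟨l, hl⟩ => apply_eq_zero_of_time (ha k) (F j) (hT j) y ⟨l, Or.inl hl⟩
  have hp : ∀ᶠ k in atTop, 0 ≤ (pk k).re ∧ (pk k).im = 0 :=
    Eventually.of_forall fun k => rpSquare_fieldObs_nonneg r (hL k) (hβ k) (ak k) F (hFvan k) (mk k)
  -- P: the square as the shifted sum, for `T < aₖ Lₖ`
  set Pk : ℕ → Fin N → Fin N → ℂ := fun k i j =>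
    ∑ q ∈ Fintype.piFinset (fun _ : Fin (deg i) => Finset.univ.filter fun pl : Fin 4 × Fin 4 => pl.1 < pl.2),
      ∑ p ∈ Fintype.piFinset (fun _ : Fin (deg j) => Finset.univ.filter fun pl : Fin 4 × Fin 4 => pl.1 < pl.2),
      ∑ x ∈ Fintype.piFinset (fun _ : Fin (deg i) => box 4 (Lk k)),
      ∑ y ∈ Fintype.piFinset (fun _ : Fin (deg j) => box 4 (Lk k)),
        conj (F i (fun l => timeReflection 4 (ak k • siteToE (x (Fin.rev l))) +
            (ak k * (1 - if (q (Fin.rev l)).1 = 0 then 1 else 0)) • siteToE (Pi.single (0 : Fin 4) (1 : ℤ)))) *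
          F j (fun l => ak k • siteToE (y l)) *
          (torusMomentStr r.ρ (βk k) (Lk k)
            (fun l U => plaquetteObs r.ρ 0 (Fin.append q p l).1 (Fin.append q p l).2 U)
            (Fin.append (fun l => wilsonTorusMean r.ρ (βk k) (Lk k) (fun U => plaquetteObs r.ρ 0 (q l).1 (q l).2 U))
              (fun l => wilsonTorusMean r.ρ (βk k) (Lk k) (fun U => plaquetteObs r.ρ 0 (p l).1 (p l).2 U)))
            (Fin.append x y) : ℂ) with hPk
  have hpk_eq : ∀ᶠ k in atTop, pk k = ∑ i, ∑ j, Pk k i j := by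
    filter_upwards [haL.eventually_gt_atTop T] with k hk
    rw [hpk]
    dsimp only
    rw [wilsonExpectation_rpSquare_eq]
    refine Finset.sum_congr rfl fun i _ => Finset.sum_congr rfl fun j _ => ?_
    rw [rpTerm_eq_shifted r (βk k) (Lk k) (ha k) hk (F i) (hT i) (F j) (mk k)]
  -- Z − P = O(aₖ), pair by pair
  set Sp : Fin N → Fin N → ℝ := fun i j => SchwartzMap.seminorm ℂ 0 (4 * (deg i + deg j) + 1) (H i j) +
    SchwartzMap.seminorm ℂ (6 * (deg i + deg j)) (4 * (deg i + deg j) + 1) (H i j) + SchwartzMap.seminorm ℂ 0 1 (H i j) +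
    SchwartzMap.seminorm ℂ (6 * (deg i + deg j)) 1 (H i j) + SchwartzMap.seminorm ℂ (10 * (deg i + deg j)) 1 (H i j) with hSp
  set C : ℝ := ∑ i, ∑ j, 6 ^ deg i * 6 ^ deg j * (2 * K ^ (deg i + deg j) * Sp i j) with hC
  have hpair : ∀ k i j, ‖latticeDist r.ρ (βk k) (Lk k) (ak k) r.curvature.F
      (wilsonTorusMean r.ρ (βk k) (Lk k) r.curvature.F) (deg i + deg j) (H i j) - Pk k i j‖ ≤
      6 ^ deg i * 6 ^ deg j * (2 * ak k * K ^ (deg i + deg j) * Sp i j) := by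
    intro k i j
    refine norm_rpDefect_le r (βk k) (Lk k) (ha k).le hK (F i) (F j) (H i j) (hH i j) fun rr hrr c hc => ?_
    rcases Nat.lt_or_ge (deg i + deg j) 2 with h2 | h2
    · rw [defectSum_eq_zero_of_le_one r (βk k) (Lk k) (ak k) (by omega) rr (H i j) c, norm_zero]
      have : 0 ≤ Sp i j := by rw [hSp]; positivity
      positivity
    · exact hdef k _ h2 rr hrr (H i j) (hHoff i j) c hc
  have hnear : ∀ᶠ k in atTop, ‖zk k - pk k‖ ≤ ak k * C := by
    filter_upwards [hpk_eq] with k hk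
    rw [hk, hzk]
    dsimp only
    rw [← Finset.sum_sub_distrib]
    simp_rw [← Finset.sum_sub_distrib]
    calc _ ≤ ∑ i, ‖∑ j, (latticeDist r.ρ (βk k) (Lk k) (ak k) r.curvature.F
          (wilsonTorusMean r.ρ (βk k) (Lk k) r.curvature.F) (deg i + deg j) (H i j) - Pk k i j)‖ := norm_sum_le _ _
      _ ≤ ∑ i, ∑ j, 6 ^ deg i * 6 ^ deg j * (2 * ak k * K ^ (deg i + deg j) * Sp i j) :=
          Finset.sum_le_sum fun i _ => (norm_sum_le _ _).trans (Finset.sum_le_sum fun j _ => hpair k i j)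
      _ = ak k * C := by
          rw [hC, Finset.mul_sum]
          refine Finset.sum_congr rfl fun i _ => ?_
          rw [Finset.mul_sum]
          exact Finset.sum_congr rfl fun j _ => by ring
  have hε : Tendsto (fun k => ak k * C) atTop (𝓝 0) := by simpa using ha0.mul_const C
  exact nonneg_of_tendsto_of_near hz hp hε hnear

/-! ### E2 by density -/

/-- Cutting off a time-ordered test function keeps it time-ordered and gives it compact time support. -/
theorem cutoff_props {m : ℕ} {F u : 𝓢((Fin m → E4), ℂ)} (hF : IsTimeOrdered F) {R : ℝ}
    (hu : tsupport (u : (Fin m → E4) → ℂ) ⊆ tsupport (F : (Fin m → E4) → ℂ) ∩ Metric.closedBall 0 R) :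
    IsTimeOrdered u ∧ ∀ x : Fin m → E4, (∃ l, x l 0 ≤ 0 ∨ R < x l 0) → u x = 0 := by
  refine ⟨(hu.trans Set.inter_subset_left).trans hF, fun x hx => ?_⟩
  by_contra hne
  have hmem : x ∈ tsupport (u : (Fin m → E4) → ℂ) := subset_tsupport _ hne
  obtain ⟨l, hl | hl⟩ := hx
  · exact absurd ((hF (hu hmem).1).1 l) (not_lt.2 hl)
  · have h1 : ‖x‖ ≤ R := mem_closedBall_zero_iff.1 (hu hmem).2
    have h2 : x l 0 ≤ ‖x‖ :=
      ((le_abs_self _).trans (by simpa using PiLp.norm_apply_le (x l) 0)).trans (norm_le_pi_norm x l)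
    linarith

/-- **E2 (reflection positivity) of the soft limit.** -/
theorem isReflectionPositive_of_softLimit (r : LatticeRep G) {βk : ℕ → ℝ} {Lk : ℕ → ℕ} {ak : ℕ → ℝ} {K : ℝ}
    (hK : 0 ≤ K) (hβ : ∀ k, 0 ≤ βk k) (hL : ∀ k, 1 ≤ Lk k) (ha : ∀ k, 0 < ak k) (ha0 : Tendsto ak atTop (𝓝 0))
    (haL : Tendsto (fun k => ak k * Lk k) atTop atTop) (S₁ : SchwingerFamily E4)
    (hlim : ∀ (m : ℕ) (F : 𝓢((Fin m → E4), ℂ)), (2 ≤ m → IsOffDiagonal F) →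
      Tendsto (fun k => latticeDist r.ρ (βk k) (Lk k) (ak k) r.curvature.F
        (wilsonTorusMean r.ρ (βk k) (Lk k) r.curvature.F) m F) atTop (𝓝 (S₁ m F)))
    (hdef : ∀ (k m : ℕ), 2 ≤ m → ∀ rr : Fin m → Fin 4 × Fin 4, (∀ i, (rr i).1 < (rr i).2) →
      ∀ F : 𝓢((Fin m → E4), ℂ), IsOffDiagonal F → ∀ c : Fin m → E4, (∀ l, ‖c l‖ ≤ ak k) →
        ‖∑ z ∈ Fintype.piFinset (fun _ : Fin m => box 4 (Lk k)),
            ((torusMomentStr r.ρ (βk k) (Lk k) (fun i U => plaquetteObs r.ρ 0 (rr i).1 (rr i).2 U)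
              (fun i => wilsonTorusMean r.ρ (βk k) (Lk k) (fun U => plaquetteObs r.ρ 0 (rr i).1 (rr i).2 U)) z : ℝ) : ℂ) *
            (F ((fun l => ak k • siteToE (z l)) + c) - F (fun l => ak k • siteToE (z l)))‖ ≤
          2 * ‖c‖ * K ^ m * (SchwartzMap.seminorm ℂ 0 (4 * m + 1) F + SchwartzMap.seminorm ℂ (6 * m) (4 * m + 1) F +
            SchwartzMap.seminorm ℂ 0 1 F + SchwartzMap.seminorm ℂ (6 * m) 1 F + SchwartzMap.seminorm ℂ (10 * m) 1 F)) :
    S₁.toLabelled.IsReflectionPositive := by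
  classical
  intro N deg lab F hF H hH
  -- cutoffs
  choose u hu_supp hu_lim using fun j => exists_tsupport_subset_inter_closedBall_tendsto (F j)
  -- the approximating OS forms are non-negative
  have hstep : ∀ m : ℕ, let zm := ∑ i, ∑ j, S₁ (deg i + deg j) ((osAdjoint (u i m)).appendTensor (u j m))
      0 ≤ zm.re ∧ zm.im = 0 := by
    intro m
    have hprops := fun j => cutoff_props (hF j) (hu_supp j m)
    exact rp_nonneg_of_compactTime r hK hβ hL ha ha0 haL S₁ hlim hdef (fun j => u j m) (fun j => (hprops j).1)
      (T := 2 * ((m : ℝ) + 1)) (fun j x hx => (hprops j).2 x hx) _ (fun i j x => SchwartzMap.appendTensor_apply _ _ x)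
  -- and converge to the OS form of `F`
  have hHeq : ∀ i j, H i j = (osAdjoint (F i)).appendTensor (F j) := fun i j => by
    ext x; rw [hH i j x, SchwartzMap.appendTensor_apply]
  have hconv : Tendsto (fun m => ∑ i, ∑ j, S₁ (deg i + deg j) ((osAdjoint (u i m)).appendTensor (u j m))) atTop
      (𝓝 (∑ i, ∑ j, S₁.toLabelled (deg i + deg j) (Fin.append (lab i ∘ Fin.rev) (lab j)) (H i j))) := by
    refine tendsto_finsetSum _ fun i _ => tendsto_finsetSum _ fun j _ => ?_
    rw [SchwingerFamily.toLabelled_apply, hHeq i j]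
    exact ((S₁ (deg i + deg j)).continuous.tendsto _).comp
      (SchwartzMap.tendsto_appendTensor ((continuous_osAdjoint.tendsto _).comp (hu_lim i)) (hu_lim j))
  have hre := (Complex.continuous_re.tendsto _).comp hconv
  have him := (Complex.continuous_im.tendsto _).comp hconv
  exact ⟨ge_of_tendsto' hre fun m => (hstep m).1,
    tendsto_nhds_unique him (tendsto_const_nhds.congr fun m => ((hstep m).2).symm)⟩

end Summit.QuantumFields.YangMills.Theorems.OSLegsFromFemtoAndGap

end
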